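import Mathlib.RingTheory.Valuation.ValuationSubring
import Mathlib.Algebra.Polynomial.GroupRingAction
import Mathlib.Algebra.Polynomial.Lifts
import Mathlib.Algebra.Polynomial.Derivative
import Mathlib.Algebra.Polynomial.Div
import Literature.AlgebraicGeometry.Resolution.KrullRamificationHenselRoots
import Literature.AlgebraicGeometry.Resolution.ArithmeticalThreefoldsLocalFrameDim
import HarnessLib

/-!
# A henselian generator is moved by a unit: trivial inertia on any model containing it ([CoP1] Prop. 9.3, "`Gⁱ(S₀ⁱ/S₀ˢ) = Gal(Kⁱ/Kˢ)`")

Topic: `Literature/AlgebraicGeometry/Resolution`. PROOF side of `CossartPiltant2019ReductionP`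
(`ArithmeticalThreefoldsLocal.lean`), input (C4), inertia layer of [CoP1] Prop. 9.3. The
residual input `hStabIloc` of `cossartPiltant2019ReductionP_of_cjs_of_stableInertiaLocalRing`
(`ArithmeticalThreefoldsLocalDescentInertiaStableLocalRing.lean`) asks, besides `Gˢ`-stability
of the local ring of a local uniformization of the inertia field, that every `τ ∈ Gˢ ∖ Gⁱ`
move some element of that local ring by a `v`-unit (the model-level form of the printed
"`Gⁱ(S₀ⁱ/S₀ˢ) = Gˢ(W/V)/Gⁱ(W/V) = Gal(Kⁱ/Kˢ)`", HAL p. 28, there obtained from Prop. 6.2 and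
Lemma 6.1 for fine enough models). This file shows the condition is met by any model whose local
ring contains a HENSELIAN GENERATOR `η` of the inertia field (`KrullRamificationHenselRoots`:
`Mⁱ = Mˢ(η)`, `F(η) = 0` with `F` monic over `O ∩ Mˢ` and `v(F′(η)) = 0`): an automorphism `g`
preserving `O`, fixing the coefficients of `F` and moving `η` moves it by a unit. Proof:
`F = (X − η)·G` over `O`, `G(η) = F′(η)`; `F(gη) = g(F(η)) = 0` and `gη ≠ η` give `G(gη) = 0`;
`(η − gη) ∣ G(η) − G(gη) = F′(η)` in `O`, so `v(η − gη) ≥ v(F′(η)) = 0`.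

* `valuation_smul_sub_eq_one_of_henselRoot` — PROVED (abstract valued field with group action);
* `valuation_map_sub_eq_one_of_henselRoot_inertiaField` — PROVED: in the climbing frame
  (`N | M` finite Galois inside `Ω`, `Gˢ ⊇ Gⁱ` of `V ∩ N`), for the henselian generator `η` of
  the inertia field `Mⁱ = Mˢ(η)` of `exists_henselRoot_toSubfield_inertiaField_eq` and every
  `τ ∈ Gˢ ∖ Gⁱ`: `v(τη − η) = 0`.

Everything is PROVED; no named facts, definitions, instances or notation are introduced.

## Sources

* V. Cossart, O. Piltant, J. Algebra 320 (2008) 1051–1082: proof of Prop. 9.3 (HAL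
  hal-00139124, p. 28), Lemma 6.1, Prop. 6.2. [CossartPiltant2008]
* O. Zariski, P. Samuel, *Commutative Algebra* II (1960), Ch. VI §12 (inertia group). [ZariskiSamuel1960]
-/

namespace Literature.AlgebraicGeometry.Resolution

universe u v

open _root_.Polynomial

section HenselRoot

variable {F : Type u} [Field F] (O : ValuationSubring F)
  {G : Type v} [Group G] [MulSemiringAction G F]

/-- **A henselian root is moved by a unit.** Let `g` be an automorphism of the field `F`
preserving the valuation ring `O`, `P` a monic polynomial with coefficients in `O` fixed by `g`,
and `η ∈ O` a root of `P` with `v(P′(η)) = 0`. If `g η ≠ η` then `v(g η − η) = 0` (written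
multiplicatively: `O.valuation (g • η - η) = 1`) — `g` acts non-trivially on the residue field
of any local ring containing `η` ("`Gⁱ(S₀ⁱ/S₀ˢ) = Gal(Kⁱ/Kˢ)`").
[cite: CossartPiltant2008, proof of Prop. 9.3 (HAL p. 28); ZariskiSamuel1960, Ch. VI §12] -/
theorem valuation_smul_sub_eq_one_of_henselRoot
    (hGO : ∀ (g : G) (x : F), x ∈ O → g • x ∈ O)
    (P : F[X]) (hPmon : P.Monic) (hPO : ∀ k, P.coeff k ∈ O) (g : G)
    (hPg : ∀ k, g • P.coeff k = P.coeff k) {η : F} (hη : η ∈ O) (hPη : P.eval η = 0)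
    (hP' : O.valuation ((derivative P).eval η) = 1) (hne : g • η ≠ η) :
    O.valuation (g • η - η) = 1 := by
  classical
  -- lift `P` to `O[X]`
  have hl : P ∈ Polynomial.lifts (algebraMap O F) := by
    rw [Polynomial.lifts_iff_coeff_lifts]
    intro k
    exact ⟨⟨P.coeff k, hPO k⟩, rfl⟩
  obtain ⟨P₀, hP₀, -, hP₀mon⟩ := Polynomial.lifts_and_degree_eq_and_monic hl hPmon
  set η₀ : O := ⟨η, hη⟩ with hη₀
  set ζ₀ : O := ⟨g • η, hGO g η hη⟩ with hζ₀
  have hι : Function.Injective (algebraMap O F) := Subtype.val_injective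
  have hmapev : ∀ x : O, algebraMap O F (P₀.eval x) = P.eval (x : F) := fun x => by
    rw [← Polynomial.eval₂_hom, ← Polynomial.eval_map, hP₀]; rfl
  -- `η₀` and `ζ₀ = g η` are roots of `P₀`
  have hroot : P₀.IsRoot η₀ := by
    rw [Polynomial.IsRoot.def]
    apply hι
    rw [hmapev, map_zero]
    exact hPη
  have hgP : g • P = P := Polynomial.ext fun k => by rw [Polynomial.coeff_smul, hPg]
  have hrootζ : P₀.eval ζ₀ = 0 := by
    apply hι
    rw [hmapev, map_zero]
    change P.eval (g • η) = 0
    rw [← hgP, Polynomial.smul_eval_smul, hPη, smul_zero]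
  -- `P₀ = (X - η₀) Q₀`, `P₀'(η₀) = Q₀(η₀)`, `Q₀(ζ₀) = 0`
  set Q₀ := P₀ /ₘ (X - C η₀) with hQ₀
  have hmul : (X - C η₀) * Q₀ = P₀ := Polynomial.mul_divByMonic_eq_iff_isRoot.mpr hroot
  have hder : (derivative P₀).eval η₀ = Q₀.eval η₀ := by
    rw [← hmul, Polynomial.derivative_mul]
    simp only [Polynomial.derivative_sub, Polynomial.derivative_X, Polynomial.derivative_C,
      sub_zero, one_mul, Polynomial.eval_add, Polynomial.eval_mul, Polynomial.eval_sub,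
      Polynomial.eval_X, Polynomial.eval_C, sub_self, zero_mul, add_zero]
  have hne₀ : ζ₀ - η₀ ≠ 0 := by
    intro h
    apply hne
    have := congrArg (fun x : O => (x : F)) (sub_eq_zero.mp h)
    exact this
  have hQζ : Q₀.eval ζ₀ = 0 := by
    have h1 : (ζ₀ - η₀) * Q₀.eval ζ₀ = 0 := by
      have := congrArg (Polynomial.eval ζ₀) hmul
      rw [Polynomial.eval_mul, Polynomial.eval_sub, Polynomial.eval_X, Polynomial.eval_C,
        hrootζ] at this
      exact this
    exact (mul_eq_zero.mp h1).resolve_left hne₀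
  -- `(η₀ - ζ₀) ∣ Q₀(η₀) - Q₀(ζ₀) = P₀'(η₀)`
  have hdvd : (η₀ - ζ₀) ∣ (derivative P₀).eval η₀ := by
    rw [hder, ← sub_zero (Q₀.eval η₀), ← hQζ]
    exact Polynomial.sub_dvd_eval_sub η₀ ζ₀ Q₀
  obtain ⟨c, hc⟩ := hdvd
  -- valuations
  have hderF : algebraMap O F ((derivative P₀).eval η₀) = (derivative P).eval η := by
    rw [← Polynomial.eval₂_hom, ← Polynomial.eval_map, ← Polynomial.derivative_map, hP₀]
    rfl
  have hv1 : O.valuation ((η₀ - ζ₀ : O) : F) * O.valuation (c : F) = 1 := by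
    rw [← Valuation.map_mul, ← MulMemClass.coe_mul, ← hc]
    change O.valuation (algebraMap O F ((derivative P₀).eval η₀)) = 1
    rw [hderF, hP']
  have hle₁ : O.valuation ((η₀ - ζ₀ : O) : F) ≤ 1 := (O.valuation_le_one_iff _).mpr (η₀ - ζ₀).2
  have hle₂ : O.valuation (c : F) ≤ 1 := (O.valuation_le_one_iff _).mpr c.2
  have hge : 1 ≤ O.valuation ((η₀ - ζ₀ : O) : F) := by
    calc (1 : _) = O.valuation ((η₀ - ζ₀ : O) : F) * O.valuation (c : F) := hv1.symm
      _ ≤ O.valuation ((η₀ - ζ₀ : O) : F) * 1 := mul_le_mul_right hle₂ _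
      _ = O.valuation ((η₀ - ζ₀ : O) : F) := mul_one _
  have heq : O.valuation ((η₀ - ζ₀ : O) : F) = 1 := le_antisymm hle₁ hge
  rw [← Valuation.map_neg, neg_sub]
  exact heq

end HenselRoot

/-! ## In the climbing frame: the henselian generator of the inertia field -/

section Frame

open _root_.IntermediateField

variable {Ω : Type u} [Field Ω] (V : ValuationSubring Ω) {M : Subfield Ω}
  (N : IntermediateField M Ω) [FiniteDimensional M N]

/-- **Every `τ ∈ Gˢ ∖ Gⁱ` moves the henselian generator of the inertia field by a unit.** For
`N | M` finite Galois inside the valued field `(Ω, V)` with decomposition group `Gˢ` and inertia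
group `Gⁱ` of `V ∩ N`, let `η ∈ V ∩ N` be a root of a monic `F` with coefficients in `V ∩ Mˢ` and
`v(F′(η)) = 0` such that `Mⁱ = Mˢ(η)` (`exists_henselRoot_toSubfield_inertiaField_eq`). Then
`v(τ η − η) = 0` for every `τ ∈ Gˢ ∖ Gⁱ`: `τ η ≠ η` since `τ` fixes `Mˢ` but not `Mⁱ = Mˢ(η)`
(Galois correspondence), and `valuation_smul_sub_eq_one_of_henselRoot` applies inside `N`. Hence
any local ring containing `η` carries a residually faithful action of `Gˢ/Gⁱ`
("`Gⁱ(S₀ⁱ/S₀ˢ) = Gal(Kⁱ/Kˢ)`"). [cite: CossartPiltant2008, proof of Prop. 9.3 (HAL p. 28); ZariskiSamuel1960, Ch. VI §12] -/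
theorem valuation_map_sub_eq_one_of_henselRoot_inertiaField {η : Ω} (hηV : η ∈ V) (hηN : η ∈ N)
    (F : Polynomial Ω) (hFmon : F.Monic)
    (hFcoeff : ∀ k, F.coeff k ∈ V ∧
      F.coeff k ∈ (lift (fixedField (decompositionGroupIn V N))).toSubfield)
    (hFη : F.eval η = 0) (hF' : V.valuation ((derivative F).eval η) = 1)
    (hgen : (lift (fixedField (inertiaGroupIn V N))).toSubfield =
      (IntermediateField.adjoin (lift (fixedField (decompositionGroupIn V N))).toSubfield
        ({η} : Set Ω)).toSubfield)
    {τ : N ≃ₐ[M] N} (hτs : τ ∈ decompositionGroupIn V N) (hτi : τ ∉ inertiaGroupIn V N) :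
    V.valuation (((τ ⟨η, hηN⟩ : N) : Ω) - η) = 1 := by
  classical
  let ι : N →+* Ω := algebraMap N Ω
  let O' : ValuationSubring N := V.comap ι
  have hO' : ∀ x : N, x ∈ O' ↔ (x : Ω) ∈ V := fun _ => Iff.rfl
  let G := ↥(decompositionGroupIn V N)
  have hsmul : ∀ (g : G) (x : N), g • x = (g : N ≃ₐ[M] N) x := fun _ _ => rfl
  have hGO : ∀ (g : G) (x : N), x ∈ O' → g • x ∈ O' := fun g x hx =>
    (hO' _).mpr ((((mem_decompositionGroupIn_iff V N g.1).mp g.2) x).mp ((hO' x).mp hx))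
  set ηN : N := ⟨η, hηN⟩ with hηNdef
  -- `F` read in `N`
  have hcoN : ∀ k, F.coeff k ∈ N := fun k => lift_le _ (show F.coeff k ∈ lift _ from (hFcoeff k).2)
  have hl : F ∈ Polynomial.lifts ι := by
    rw [Polynomial.lifts_iff_coeff_lifts]
    exact fun k => ⟨⟨F.coeff k, hcoN k⟩, rfl⟩
  obtain ⟨P, hP, -, hPmon⟩ := Polynomial.lifts_and_degree_eq_and_monic hl hFmon
  have hPcoeff : ∀ k, (P.coeff k : Ω) = F.coeff k := fun k => by
    rw [← hP, Polynomial.coeff_map]; rfl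
  have hPO : ∀ k, P.coeff k ∈ O' := fun k => (hO' _).mpr (by rw [hPcoeff]; exact (hFcoeff k).1)
  let g : G := ⟨τ, hτs⟩
  have hPg : ∀ k, g • P.coeff k = P.coeff k := by
    intro k
    rw [hsmul]
    have h2 : ((P.coeff k : N) : Ω) ∈ lift (fixedField (decompositionGroupIn V N)) := by
      rw [hPcoeff]
      exact (hFcoeff k).2
    have h1 : P.coeff k ∈ fixedField (decompositionGroupIn V N) :=
      (IntermediateField.mem_lift (P.coeff k)).mp h2
    exact (mem_fixedField_iff _ _).mp h1 τ hτs
  have hηO : ηN ∈ O' := (hO' _).mpr hηV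
  have hPη : P.eval ηN = 0 := by
    apply ι.injective
    rw [← Polynomial.eval₂_hom, ← Polynomial.eval_map, hP, map_zero]
    exact hFη
  have hP' : O'.valuation ((derivative P).eval ηN) = 1 := by
    rw [valuation_comap_ringHom_eq_one_iff V ι, ← Polynomial.eval₂_hom, ← Polynomial.eval_map,
      ← Polynomial.derivative_map, hP]
    exact hF'
  -- `τ η ≠ η`: otherwise `τ` fixes `Mˢ(η) = Mⁱ` pointwise, i.e. `τ ∈ Gⁱ`
  have hne : g • ηN ≠ ηN := by
    intro heq
    rw [hsmul] at heq
    apply hτi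
    rw [← IntermediateField.fixingSubgroup_fixedField (inertiaGroupIn V N),
      IntermediateField.mem_fixingSubgroup_iff]
    -- the subfield of `Ω` of elements of `N` fixed by `τ`, over `Mˢ`
    let K₀ : Subfield Ω := (lift (fixedField (decompositionGroupIn V N))).toSubfield
    let L : IntermediateField K₀ Ω :=
      { carrier := {x | ∃ hx : x ∈ N, τ ⟨x, hx⟩ = ⟨x, hx⟩}
        mul_mem' := by
          rintro a b ⟨ha, hτa⟩ ⟨hb, hτb⟩
          refine ⟨N.mul_mem ha hb, ?_⟩
          have : (⟨a * b, N.mul_mem ha hb⟩ : N) = ⟨a, ha⟩ * ⟨b, hb⟩ := rfl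
          rw [this, map_mul, hτa, hτb]
        one_mem' := ⟨N.one_mem, by
          have : (⟨1, N.one_mem⟩ : N) = 1 := rfl
          rw [this, map_one]⟩
        add_mem' := by
          rintro a b ⟨ha, hτa⟩ ⟨hb, hτb⟩
          refine ⟨N.add_mem ha hb, ?_⟩
          have : (⟨a + b, N.add_mem ha hb⟩ : N) = ⟨a, ha⟩ + ⟨b, hb⟩ := rfl
          rw [this, map_add, hτa, hτb]
        zero_mem' := ⟨N.zero_mem, by
          have : (⟨0, N.zero_mem⟩ : N) = 0 := rfl
          rw [this, map_zero]⟩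
        algebraMap_mem' := by
          intro c
          have hcN : (c : Ω) ∈ N := lift_le _ (show (c : Ω) ∈ lift _ from c.2)
          refine ⟨hcN, ?_⟩
          have h1 : (⟨(c : Ω), hcN⟩ : N) ∈ fixedField (decompositionGroupIn V N) :=
            (IntermediateField.mem_lift (⟨(c : Ω), hcN⟩ : N)).mp c.2
          exact (mem_fixedField_iff _ _).mp h1 τ hτs
        inv_mem' := by
          rintro a ⟨ha, hτa⟩
          refine ⟨N.inv_mem ha, ?_⟩
          have : (⟨a⁻¹, N.inv_mem ha⟩ : N) = (⟨a, ha⟩ : N)⁻¹ := rfl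
          rw [this, map_inv₀, hτa] }
    have hηL : η ∈ L := ⟨hηN, heq⟩
    have hle : IntermediateField.adjoin K₀ ({η} : Set Ω) ≤ L :=
      IntermediateField.adjoin_le_iff.mpr (Set.singleton_subset_iff.mpr hηL)
    intro x hx
    -- `x ∈ fixedField Gⁱ`, so `(x : Ω) ∈ Mⁱ = Mˢ(η) ≤ L`
    have hxΩ : (x : Ω) ∈ (IntermediateField.adjoin K₀ ({η} : Set Ω)).toSubfield := by
      rw [← hgen]
      exact (IntermediateField.mem_lift x).mpr hx
    have hxL : (x : Ω) ∈ L := hle hxΩ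
    obtain ⟨hxN, hτx⟩ := hxL
    have : (⟨(x : Ω), hxN⟩ : N) = x := Subtype.ext rfl
    rw [this] at hτx
    exact hτx
  have key := valuation_smul_sub_eq_one_of_henselRoot O' hGO P hPmon hPO g hPg hηO hPη hP' hne
  rw [valuation_comap_ringHom_eq_one_iff V ι, map_sub] at key
  have e : ((τ ηN : N) : Ω) - η = ι (g • ηN) - ι ηN := rfl
  rw [e]
  exact key

end Frame

end Literature.AlgebraicGeometry.Resolution
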